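import Literature.AlgebraicGeometry.Motives.CyclesPushforwardNormProofs
import Mathlib.AlgebraicGeometry.Morphisms.Integral
import Mathlib.AlgebraicGeometry.Morphisms.Finite
import HarnessLib

/-!
# Residue field extensions along integral and finite morphisms

Topic: `Literature/AlgebraicGeometry/Resolution`. Generic scheme theory serving de Jong 1996,
4.15–4.16 (`AlterationsSectionsReduction.lean`): along the finite normalisation `ψ : Y' → Y` the
fibres of the strict transform are the fibres of `f` base-changed along the residue field
extensions `κ(ψ y') ⊂ κ(y')`, which must be algebraic (so that `Spec κ(y') → Spec κ(ψ y')` is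
integral); and in 4.16 the residue fields `k(Zᵢ)` of the generic points of `Z`, finite over
`Y`, must be finite over `k(Y)`. Everything here is PROVED, on affine charts `U = Spec R ∋ p x`,
`p⁻¹U = Spec S ∋ x`, where `κ(p x) = Frac(R/𝔭)` and `κ(x) = Frac(S/𝔮)` for the primes `𝔮 ⊂ S`
over `𝔭 ⊂ R` of the two points:

* `isAlgebraic_and_finite_residueField_chart` — `κ(x)` is algebraic, resp. finite, over
  `κ(p x)` as soon as `S/𝔮` is integral, resp. finite, over `R/𝔭`;
* `Scheme.Hom.isAlgebraic_residueField_of_isIntegralHom` — **for `p : X → Y` integral, `κ(x)`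
  is algebraic over `κ(p x)`**;
* `Scheme.Hom.finite_residueField_of_isFinite` — **for `p` finite, `κ(x)` is finite over
  `κ(p x)`**;
* `Scheme.Hom.isIntegralHom_SpecMap_residueFieldMap` — hence `Spec κ(x) → Spec κ(p x)` is
  integral for `p` integral.

## Sources

* The Stacks Project, Tag 00GT ff. (integral extensions and residue fields), Tag 01WJ (finite
  morphisms).
-/

noncomputable section

open CategoryTheory CategoryTheory.Limits AlgebraicGeometry TopologicalSpace Topology IsLocalRing

namespace Literature.AlgebraicGeometry.Resolution

universe u

section Chart

variable {X Y : Scheme.{u}} (p : X ⟶ Y) {U : Y.Opens} (hU : IsAffineOpen U)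
  (hU' : IsAffineOpen (p ⁻¹ᵁ U)) (x : ↥(p ⁻¹ᵁ U))

/-- **Residue fields on an affine chart.** For `x ∈ p⁻¹(U)`, `U = Spec R` affine with
`p⁻¹U = Spec S` affine, and the primes `𝔭 ⊂ R` of `p x` and `𝔮 ⊂ S` of `x` (`𝔮` lies over `𝔭`,
`Literature.AlgebraicGeometry.Motives.comap_app_primeIdealOf`): the residue field `κ(x)` is
algebraic, resp. finite, over `κ(p x)` as soon as `S/𝔮` is integral, resp. finite, over `R/𝔭`
— `κ(p x) = Frac(R/𝔭)` and `κ(x) = Frac(S/𝔮)` compatibly, the local rings being `R_𝔭` and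
`S_𝔮`. [folklore] -/
theorem isAlgebraic_and_finite_residueField_chart :
    letI : Algebra Γ(Y, U) Γ(X, p ⁻¹ᵁ U) := (p.app U).hom.toAlgebra
    letI : Algebra (Y.residueField (p.base x)) (X.residueField (x : X)) :=
      (p.residueFieldMap (x : X)).hom.toAlgebra
    ∀ (_ : (hU'.primeIdealOf x).asIdeal.LiesOver (hU.primeIdealOf ⟨p.base x, x.2⟩).asIdeal),
    (Algebra.IsIntegral (Γ(Y, U) ⧸ (hU.primeIdealOf ⟨p.base x, x.2⟩).asIdeal)
        (Γ(X, p ⁻¹ᵁ U) ⧸ (hU'.primeIdealOf x).asIdeal) →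
      Algebra.IsAlgebraic (Y.residueField (p.base x)) (X.residueField (x : X))) ∧
    (Module.Finite (Γ(Y, U) ⧸ (hU.primeIdealOf ⟨p.base x, x.2⟩).asIdeal)
        (Γ(X, p ⁻¹ᵁ U) ⧸ (hU'.primeIdealOf x).asIdeal) →
      Module.Finite (Y.residueField (p.base x)) (X.residueField (x : X))) := by
  intro hover
  letI algRS : Algebra Γ(Y, U) Γ(X, p ⁻¹ᵁ U) := (p.app U).hom.toAlgebra
  -- the local rings as localisations of the coordinate rings at `𝔭`, `𝔮`
  letI aY : Algebra Γ(Y, U) (Y.presheaf.stalk (p.base x)) :=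
    TopCat.Presheaf.algebra_section_stalk Y.presheaf (⟨p.base x, x.2⟩ : U)
  haveI hloc : IsLocalization.AtPrime (Y.presheaf.stalk (p.base x))
      (hU.primeIdealOf ⟨p.base x, x.2⟩).asIdeal := hU.isLocalization_stalk ⟨p.base x, x.2⟩
  haveI := hU'.isLocalization_stalk x
  -- the residue fields `κY = κ(p x)`, `κX = κ(x)` as fraction fields of `R/𝔭`, `S/𝔮`
  letI aRk : Algebra Γ(Y, U) (ResidueField (Y.presheaf.stalk (p.base x))) :=
    inferInstanceAs (Algebra Γ(Y, U) (Y.presheaf.stalk (p.base x) ⧸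
      maximalIdeal (Y.presheaf.stalk (p.base x))))
  letI aRpk : Algebra (Γ(Y, U) ⧸ (hU.primeIdealOf ⟨p.base x, x.2⟩).asIdeal) (ResidueField (Y.presheaf.stalk (p.base x))) :=
    inferInstanceAs (Algebra (Γ(Y, U) ⧸ (hU.primeIdealOf ⟨p.base x, x.2⟩).asIdeal)
      (Y.presheaf.stalk (p.base x) ⧸ maximalIdeal (Y.presheaf.stalk (p.base x))))
  haveI : IsScalarTower Γ(Y, U) (Γ(Y, U) ⧸ (hU.primeIdealOf ⟨p.base x, x.2⟩).asIdeal) (ResidueField (Y.presheaf.stalk (p.base x))) :=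
    inferInstanceAs (IsScalarTower Γ(Y, U) (Γ(Y, U) ⧸ (hU.primeIdealOf ⟨p.base x, x.2⟩).asIdeal)
      (Y.presheaf.stalk (p.base x) ⧸ maximalIdeal (Y.presheaf.stalk (p.base x))))
  haveI : IsFractionRing (Γ(Y, U) ⧸ (hU.primeIdealOf ⟨p.base x, x.2⟩).asIdeal) (ResidueField (Y.presheaf.stalk (p.base x))) :=
    Literature.RingTheory.OrderOfVanishing.isFractionRing_quotient_maximalIdeal (hU.primeIdealOf ⟨p.base x, x.2⟩).asIdeal
      (Y.presheaf.stalk (p.base x))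
  letI aSk : Algebra Γ(X, p ⁻¹ᵁ U) (ResidueField (X.presheaf.stalk (x : X))) :=
    inferInstanceAs (Algebra Γ(X, p ⁻¹ᵁ U) (X.presheaf.stalk (x : X) ⧸
      maximalIdeal (X.presheaf.stalk (x : X))))
  letI aSqk : Algebra (Γ(X, p ⁻¹ᵁ U) ⧸ (hU'.primeIdealOf x).asIdeal) (ResidueField (X.presheaf.stalk (x : X))) :=
    inferInstanceAs (Algebra (Γ(X, p ⁻¹ᵁ U) ⧸ (hU'.primeIdealOf x).asIdeal)
      (X.presheaf.stalk (x : X) ⧸ maximalIdeal (X.presheaf.stalk (x : X))))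
  haveI : IsScalarTower Γ(X, p ⁻¹ᵁ U) (Γ(X, p ⁻¹ᵁ U) ⧸ (hU'.primeIdealOf x).asIdeal) (ResidueField (X.presheaf.stalk (x : X))) :=
    inferInstanceAs (IsScalarTower Γ(X, p ⁻¹ᵁ U) (Γ(X, p ⁻¹ᵁ U) ⧸ (hU'.primeIdealOf x).asIdeal)
      (X.presheaf.stalk (x : X) ⧸ maximalIdeal (X.presheaf.stalk (x : X))))
  haveI : IsFractionRing (Γ(X, p ⁻¹ᵁ U) ⧸ (hU'.primeIdealOf x).asIdeal) (ResidueField (X.presheaf.stalk (x : X))) :=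
    Literature.RingTheory.OrderOfVanishing.isFractionRing_quotient_maximalIdeal (hU'.primeIdealOf x).asIdeal
      (X.presheaf.stalk (x : X))
  -- `κX` over `κY`, over `R` through `S`, and the tower `R → κY → κX`
  letI akk : Algebra (ResidueField (Y.presheaf.stalk (p.base x))) (ResidueField (X.presheaf.stalk (x : X))) := (p.residueFieldMap (x : X)).hom.toAlgebra
  letI aRK : Algebra Γ(Y, U) (ResidueField (X.presheaf.stalk (x : X))) :=
    ((algebraMap Γ(X, p ⁻¹ᵁ U) (ResidueField (X.presheaf.stalk (x : X)))).comp (algebraMap Γ(Y, U) Γ(X, p ⁻¹ᵁ U))).toAlgebra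
  haveI : IsScalarTower Γ(Y, U) Γ(X, p ⁻¹ᵁ U) (ResidueField (X.presheaf.stalk (x : X))) := IsScalarTower.of_algebraMap_eq fun _ ↦ rfl
  have hRκκ : ∀ r : Γ(Y, U), algebraMap (ResidueField (Y.presheaf.stalk (p.base x))) (ResidueField (X.presheaf.stalk (x : X))) (algebraMap Γ(Y, U) (ResidueField (Y.presheaf.stalk (p.base x))) r) =
      algebraMap Γ(Y, U) (ResidueField (X.presheaf.stalk (x : X))) r := by
    intro r
    have e1 : algebraMap Γ(Y, U) (ResidueField (X.presheaf.stalk (x : X))) r =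
        X.residue (x : X) (X.presheaf.germ (p ⁻¹ᵁ U) x x.2 (p.app U r)) := rfl
    have e2 : algebraMap (ResidueField (Y.presheaf.stalk (p.base x))) (ResidueField (X.presheaf.stalk (x : X))) (algebraMap Γ(Y, U) (ResidueField (Y.presheaf.stalk (p.base x))) r) =
        p.residueFieldMap (x : X) (Y.residue (p.base x) (Y.presheaf.germ U (p.base x) x.2 r)) :=
      rfl
    rw [e1, e2]
    have hcomp : Y.presheaf.germ U (p.base x) x.2 ≫ Y.residue (p.base x) ≫
        p.residueFieldMap (x : X) =
        p.app U ≫ X.presheaf.germ (p ⁻¹ᵁ U) x x.2 ≫ X.residue (x : X) := by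
      rw [Scheme.residue_residueFieldMap, Scheme.Hom.germ_stalkMap_assoc]
    have := CategoryTheory.ConcreteCategory.congr_hom hcomp r
    simp only [CategoryTheory.ConcreteCategory.comp_apply] at this
    exact this
  haveI : IsScalarTower Γ(Y, U) (ResidueField (Y.presheaf.stalk (p.base x))) (ResidueField (X.presheaf.stalk (x : X))) := IsScalarTower.of_algebraMap_eq fun r ↦ (hRκκ r).symm
  -- `κX` over `R/𝔭` through `S/𝔮`, and the towers over `R/𝔭`
  letI aRpK : Algebra (Γ(Y, U) ⧸ (hU.primeIdealOf ⟨p.base x, x.2⟩).asIdeal) (ResidueField (X.presheaf.stalk (x : X))) :=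
    ((algebraMap (Γ(X, p ⁻¹ᵁ U) ⧸ (hU'.primeIdealOf x).asIdeal) (ResidueField (X.presheaf.stalk (x : X)))).comp
      (algebraMap (Γ(Y, U) ⧸ (hU.primeIdealOf ⟨p.base x, x.2⟩).asIdeal) (Γ(X, p ⁻¹ᵁ U) ⧸ (hU'.primeIdealOf x).asIdeal))).toAlgebra
  haveI : IsScalarTower (Γ(Y, U) ⧸ (hU.primeIdealOf ⟨p.base x, x.2⟩).asIdeal) (Γ(X, p ⁻¹ᵁ U) ⧸ (hU'.primeIdealOf x).asIdeal) (ResidueField (X.presheaf.stalk (x : X))) :=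
    IsScalarTower.of_algebraMap_eq fun _ ↦ rfl
  have hRpK : ∀ r : Γ(Y, U), algebraMap (Γ(Y, U) ⧸ (hU.primeIdealOf ⟨p.base x, x.2⟩).asIdeal) (ResidueField (X.presheaf.stalk (x : X))) (Ideal.Quotient.mk (hU.primeIdealOf ⟨p.base x, x.2⟩).asIdeal r) =
      algebraMap Γ(Y, U) (ResidueField (X.presheaf.stalk (x : X))) r := by
    intro r
    change algebraMap (Γ(X, p ⁻¹ᵁ U) ⧸ (hU'.primeIdealOf x).asIdeal) (ResidueField (X.presheaf.stalk (x : X)))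
      (algebraMap (Γ(Y, U) ⧸ (hU.primeIdealOf ⟨p.base x, x.2⟩).asIdeal) (Γ(X, p ⁻¹ᵁ U) ⧸ (hU'.primeIdealOf x).asIdeal) (Ideal.Quotient.mk (hU.primeIdealOf ⟨p.base x, x.2⟩).asIdeal r)) = _
    rw [Ideal.Quotient.algebraMap_mk_of_liesOver, ← Ideal.Quotient.algebraMap_eq,
      ← IsScalarTower.algebraMap_apply, ← IsScalarTower.algebraMap_apply]
  haveI : IsScalarTower (Γ(Y, U) ⧸ (hU.primeIdealOf ⟨p.base x, x.2⟩).asIdeal) (ResidueField (Y.presheaf.stalk (p.base x))) (ResidueField (X.presheaf.stalk (x : X))) := by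
    refine IsScalarTower.of_algebraMap_eq fun r ↦ ?_
    obtain ⟨r, rfl⟩ := Ideal.Quotient.mk_surjective r
    rw [hRpK, ← Ideal.Quotient.algebraMap_eq,
      ← IsScalarTower.algebraMap_apply Γ(Y, U) (Γ(Y, U) ⧸ (hU.primeIdealOf ⟨p.base x, x.2⟩).asIdeal)
        (ResidueField (Y.presheaf.stalk (p.base x))), hRκκ]
  refine ⟨fun hint => ?_, fun hfin => ?_⟩
  · -- integral `S/𝔮` over `R/𝔭`: the fraction fields are algebraic
    haveI := hint
    haveI : Algebra.IsAlgebraic (Γ(X, p ⁻¹ᵁ U) ⧸ (hU'.primeIdealOf x).asIdeal)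
        (ResidueField (X.presheaf.stalk (x : X))) :=
      IsLocalization.isAlgebraic _ (nonZeroDivisors (Γ(X, p ⁻¹ᵁ U) ⧸ (hU'.primeIdealOf x).asIdeal))
    haveI : Algebra.IsAlgebraic (Γ(Y, U) ⧸ (hU.primeIdealOf ⟨p.base x, x.2⟩).asIdeal)
        (ResidueField (X.presheaf.stalk (x : X))) :=
      Algebra.IsIntegral.trans_isAlgebraic (Γ(Y, U) ⧸ (hU.primeIdealOf ⟨p.base x, x.2⟩).asIdeal)
        (Γ(X, p ⁻¹ᵁ U) ⧸ (hU'.primeIdealOf x).asIdeal) (ResidueField (X.presheaf.stalk (x : X)))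
    exact Algebra.IsAlgebraic.extendScalars
      (R := Γ(Y, U) ⧸ (hU.primeIdealOf ⟨p.base x, x.2⟩).asIdeal)
      (S := ResidueField (Y.presheaf.stalk (p.base x))) (A := ResidueField (X.presheaf.stalk (x : X)))
      (IsFractionRing.injective (Γ(Y, U) ⧸ (hU.primeIdealOf ⟨p.base x, x.2⟩).asIdeal)
        (ResidueField (Y.presheaf.stalk (p.base x))))
  · -- finite `S/𝔮` over `R/𝔭`: the fraction fields are finite
    haveI := hfin
    exact Literature.AlgebraicGeometry.Motives.finiteDimensional_of_isFractionRing
      (Γ(Y, U) ⧸ (hU.primeIdealOf ⟨p.base x, x.2⟩).asIdeal) (Γ(X, p ⁻¹ᵁ U) ⧸ (hU'.primeIdealOf x).asIdeal) (ResidueField (Y.presheaf.stalk (p.base x))) (ResidueField (X.presheaf.stalk (x : X)))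

end Chart

/-! ## Integral and finite morphisms -/

section Morphisms

variable {X Y : Scheme.{u}} (p : X ⟶ Y)

/-- **Along an integral morphism the residue field extensions are algebraic** (Stacks 00GT
ff.): `κ(x)` is algebraic over `κ(p x)` for every `x`, `p : X → Y` integral — on an affine
chart, `S/𝔮` is integral over `R/𝔭`. [folklore] -/
theorem Scheme.Hom.isAlgebraic_residueField_of_isIntegralHom [IsIntegralHom p] (x : X) :
    letI : Algebra (Y.residueField (p.base x)) (X.residueField x) :=
      (p.residueFieldMap x).hom.toAlgebra
    Algebra.IsAlgebraic (Y.residueField (p.base x)) (X.residueField x) := by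
  obtain ⟨_, ⟨U, hU, rfl⟩, hxU, -⟩ :=
    Y.isBasis_affineOpens.exists_subset_of_mem_open (Set.mem_univ (p.base x)) isOpen_univ
  have hU : IsAffineOpen U := hU
  have hU' : IsAffineOpen (p ⁻¹ᵁ U) := hU.preimage p
  letI : Algebra Γ(Y, U) Γ(X, p ⁻¹ᵁ U) := (p.app U).hom.toAlgebra
  haveI hover : (hU'.primeIdealOf ⟨x, hxU⟩).asIdeal.LiesOver
      (hU.primeIdealOf ⟨p.base x, hxU⟩).asIdeal :=
    ⟨by rw [Ideal.under_def, RingHom.algebraMap_toAlgebra,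
      Literature.AlgebraicGeometry.Motives.comap_app_primeIdealOf p hU hU' ⟨x, hxU⟩]⟩
  haveI : Algebra.IsIntegral Γ(Y, U) Γ(X, p ⁻¹ᵁ U) := ⟨p.isIntegral_app U hU⟩
  haveI : Algebra.IsIntegral (Γ(Y, U) ⧸ (hU.primeIdealOf ⟨p.base x, hxU⟩).asIdeal)
      (Γ(X, p ⁻¹ᵁ U) ⧸ (hU'.primeIdealOf ⟨x, hxU⟩).asIdeal) :=
    Algebra.IsIntegral.tower_top (R := Γ(Y, U))
  exact (isAlgebraic_and_finite_residueField_chart p hU hU' ⟨x, hxU⟩ hover).1 ‹_›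

/-- **Along a finite morphism the residue field extensions are finite**: `κ(x)` is finite over
`κ(p x)` for every `x`, `p : X → Y` finite — on an affine chart with `R → S` finite
(`Literature.AlgebraicGeometry.Motives.exists_isAffineOpen_finite_app`), `S/𝔮` is finite over
`R/𝔭`. [cite: StacksProject, Tag 01WJ] -/
theorem Scheme.Hom.finite_residueField_of_isFinite [IsFinite p] (x : X) :
    letI : Algebra (Y.residueField (p.base x)) (X.residueField x) :=
      (p.residueFieldMap x).hom.toAlgebra
    Module.Finite (Y.residueField (p.base x)) (X.residueField x) := by
  haveI : IsFinite (p ∣_ (⊤ : Y.Opens)) := inferInstance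
  obtain ⟨U, hxU, hU, hU', hfin⟩ :=
    Literature.AlgebraicGeometry.Motives.exists_isAffineOpen_finite_app p (V := ⊤)
      (y := p.base x) (Set.mem_univ _)
  letI : Algebra Γ(Y, U) Γ(X, p ⁻¹ᵁ U) := (p.app U).hom.toAlgebra
  haveI hover : (hU'.primeIdealOf ⟨x, hxU⟩).asIdeal.LiesOver
      (hU.primeIdealOf ⟨p.base x, hxU⟩).asIdeal :=
    ⟨by rw [Ideal.under_def, RingHom.algebraMap_toAlgebra,
      Literature.AlgebraicGeometry.Motives.comap_app_primeIdealOf p hU hU' ⟨x, hxU⟩]⟩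
  haveI : Module.Finite Γ(Y, U) Γ(X, p ⁻¹ᵁ U) := RingHom.finite_algebraMap.mp hfin
  haveI : Module.Finite (Γ(Y, U) ⧸ (hU.primeIdealOf ⟨p.base x, hxU⟩).asIdeal)
      (Γ(X, p ⁻¹ᵁ U) ⧸ (hU'.primeIdealOf ⟨x, hxU⟩).asIdeal) :=
    Module.Finite.of_restrictScalars_finite Γ(Y, U) _ _
  exact (isAlgebraic_and_finite_residueField_chart p hU hU' ⟨x, hxU⟩ hover).2 ‹_›

/-- For `p : X → Y` integral, `Spec κ(x) → Spec κ(p x)` is an integral morphism. [folklore] -/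
theorem Scheme.Hom.isIntegralHom_SpecMap_residueFieldMap [IsIntegralHom p] (x : X) :
    IsIntegralHom (Spec.map (p.residueFieldMap x)) := by
  refine IsIntegralHom.SpecMap_iff.mpr ?_
  letI : Algebra (Y.residueField (p.base x)) (X.residueField x) :=
    (p.residueFieldMap x).hom.toAlgebra
  haveI := Scheme.Hom.isAlgebraic_residueField_of_isIntegralHom p x
  change (algebraMap (Y.residueField (p.base x)) (X.residueField x)).IsIntegral
  exact fun a => Algebra.IsIntegral.isIntegral a

end Morphisms

end Literature.AlgebraicGeometry.Resolution

end
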